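import Summits.BirchSwinnertonDyer.BirchSwinnertonDyer.Theorems.ClassRecordThreeCornerAtThreeUpperCoChain
import Summits.BirchSwinnertonDyer.BirchSwinnertonDyer.Theorems.EisensteinPrimesBSDpOnCellCCtlSplitClass
import Summits.BirchSwinnertonDyer.Rank1Residual.X2.NonsplitControl
import Summits.BirchSwinnertonDyer.Rank1Residual.GaloisImage.LocalEulerPoincareCharacteristicHolds
import Literature.NumberTheory.EllipticCurves.AnticyclotomicPrimeDecompositionSplitProofs
import Literature.NumberTheory.GaloisRepresentations.NumberFieldCdTwoProofs
import HarnessLib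

/-!
# Route `ClassRecordThree` (rung K2@3), crux 7 `CornerAtThree` (item stmt-BirchSwinnertonDyer-19111, shared with
# `KolyvaginRoadThree`), stub `stub_cornerUpper3` — the co-chain road, file 2: the CONTROL input (U2) on the corner
# is a THEOREM modulo four cited facts; `Three.CornerUpperAt W` hinges on ONE typed open input (U1)
# (cell `bsd-stepL`, width-lever second lane `bsd-stepL-corner3-p2`; `--supports stmt-BirchSwinnertonDyer-19111`)

HONEST FRAMING: theorems only (no definition, no named fact, no `sorry`); CONDITIONAL on cited Literature facts
taken BY NAME and, for the corner's Upper conjunct, on the OPEN input (U1) stated inline; nothing is asserted about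
any curve; item 19111 stays open; BSD is not advanced; no census word, tier or label moves (T7).

## What this file proves

File 1 (`ClassRecordThreeCornerAtThreeUpperCoChain.lean`, p527420) reduced `Three.CornerUpperAt W` — the
Tamagawa-SHARP Kolyvagin bound `ord₃ #Ш(E/K) + 2·ord₃ ∏_ℓ c_ℓ(E) ≤ 2·ord₃ [E(K):ℤP]` on the (T4″)@3 corner
(`ClassX11b W 3 ∧ ¬ Surj W 3`, `3 ∣ ∏c`) — to two inputs on the corner frames: (U1) the Kolyvagin-SYSTEM
direction of the anticyclotomic main conjecture at `𝟙` (`ord₃ f_ac(0) ≤ 2(ord₃ log_ω P − 1)`, OPEN) and (U2) the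
control identity `X11b.ControlOnTreeAt 3 κ 𝔭 γ embAt P` (Cas18 Thm. 2.3 / JSW17 Thm. 3.3.1 shape: the Tamagawa
term). Here (U2) is DISCHARGED on the corner — indeed at EVERY multiplicative rank-one datum at every odd `p`,
image-free and torsion-free — from the tree's kernel control theorems of the cells `bsd-eis` / `bsd-schneider`
(door-c4/c5/c6, cgshw, k5-c4), which are stated for Eisenstein pairs but USE NO IMAGE HYPOTHESIS:

* `controlOnTreeAt_of_mult_of_rankOne_odd` — for `W/ℚ` globally minimal of analytic rank one, an odd
  multiplicative prime `p`, `K` imaginary quadratic with `p` split and `L(E^{(d_K)},1) ≠ 0`, `P ∈ E(K)` of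
  infinite order, an anticyclotomic `κ` with topological generator `γ`, a degree-one `𝔭 ∣ p`:
  `ControlOnTreeAt p κ 𝔭 γ (embAt K p 𝔭) P`. By cases on the sign at `p`: SPLIT —
  `CtlLoc.controlOnTreeAt_of_split_anyTorsion` (torsion-robust counting: Fin_v from the Tate line, the exact local
  kernels `#ker r_w = p^{ord_p c_w}` at the finitely decomposed `w ∣ N` (Brink), Poitou–Tate surjectivity,
  `H¹_ac(K, M)_Γ = 0`); NON-SPLIT — `X2.controlOnTreeAt_of_not_split_of_rankOne` (`E(ℚ_p)[p] = 0`). Cited facts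
  consumed BY NAME: GZK (`rank_eq_analyticRank_of_analyticRank_le_one`), newforms (`exists_isNewformOf`),
  Poitou–Tate for Selmer structures and for `Ш` (`poitouTate_selmerStructure_duality`, `poitouTate_sha_tateDual`);
  Brink 2007 Thm. 2, Tate's local Euler characteristic and `cd_p K ≤ 2` are tree THEOREMS
  (`ZpExtension.decomp_not_le_kerSubgroup_of_isAnticyclotomic_holds`, `localEulerPoincareCharacteristic_holds`,
  `fieldCdLE_two_of_numberField_holds`) and are discharged here.
* `Three.cornerControlOnTree_of_facts` — (U2) at every corner frame of `Three.CornerUpperAt` (the `hctl` input of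
  `Three.cornerUpperAt_of_coIMC_of_control` VERBATIM), from the four cited facts. In particular the FULL control
  identity holds on the corner (`¬Ram`, `3 ∣ c₃` on all 129 split-corner pairs, `E(ℚ₃)[3] ≠ 0` allowed) — more than
  the `≤`-half CTL₀ᶜ consumed by lane A's StepL kit.
* **`Three.cornerUpperAt_of_coIMC_of_facts`** — `Three.CornerUpperAt W` from (U1) ALONE + the four cited facts;
  **`Three.cornerAtThreeUpper_of_coIMC_of_facts`** — the registered stub's constant `Theorems.CornerAtThreeUpper`
  (p488767) BY NAME from (U1) `∀ W` + the four cited facts.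

So along this road the corner's Upper conjunct IS the Kolyvagin-system divisibility at `𝟙` at `p = 3` for an image
in the normaliser of a Cartan — ONE typed statement; and with lane A's `CornerStepLAt` input (the OPPOSITE
inclusion at `𝟙`) the two halves over `K` are the two inclusions of one anticyclotomic main conjecture at `𝟙`.

References: [Castella2018] Thm. 2.3 (arXiv:1704.06608 p. 5), Thm. 3.2 (p. 9); [JetchevSkinnerWan2017] Thm. 3.3.1,
Prop. 3.2.1, Prop. 3.3.2, Lemma 3.3.3, Prop. 3.3.4 (arXiv:1512.06894 pp. 10–13), §7.4.2; [GreenbergLNM1716] §3;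
[Brink2007] Thm. 2, Cor. 1; [MilneADT2006] I Thm. 2.8, I Thm. 4.10; [Howard2004] Thm. B (shape of (U1)).
-/

noncomputable section

open scoped Classical

open WeierstrassCurve NumberField IsDedekindDomain Field Literature.NumberTheory.EllipticCurves
  Literature.NumberTheory.EllipticCurves.ModularForms
  Literature.NumberTheory.EllipticCurves.GreenbergSelmer
  Literature.NumberTheory.GaloisRepresentations Literature.NumberTheory.GaloisCohomology
  Literature.NumberTheory.EllipticCurves.Rank1Residual
  Literature.NumberTheory.EllipticCurves.Rank1Residual.Typed
  Literature.NumberTheory.QuadraticFields.Quadratic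
  Summit.BirchSwinnertonDyer.Rank1Residual
  Summit.BirchSwinnertonDyer.Rank1Residual.X11b.AcSelmer

namespace Summit.BirchSwinnertonDyer.Rank1Residual.X11b

/-! ### §1. The control identity at every multiplicative rank-one datum, every odd `p` — image-free, torsion-free -/

section Datum

variable (W : WeierstrassCurve ℚ) [W.IsElliptic] [W.IsGloballyMinimal] (p : ℕ) [Fact p.Prime]

/-- **Cas18 Thm. 2.3 / JSW17 Thm. 3.3.1 on the constructed `X_ac` at EVERY multiplicative rank-one datum, `p` odd,
ANY image of `E[p]`, ANY local `p`-torsion.** For `W/ℚ` globally minimal with `ord_{s=1} L(E,s) = 1` and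
multiplicative reduction at the odd prime `p`; `K` imaginary quadratic with `p` split and `L(E^{(d_K)},1) ≠ 0`
(so `rank E(K) = 1`, `Ш(E/K)` finite by GZK over `ℚ` twice); `P ∈ E(K)` of infinite order; an anticyclotomic `κ`
with topological generator `γ`; a degree-one `𝔭 ∣ p`: `ControlOnTreeAt p κ 𝔭 γ (embAt K p 𝔭) P`, i.e.
`ord_p f_ac(0) = ord_p #Ш(E/K)[p^∞] + 2((ord_p log_ω P − 1) − ord_p [E(K):ℤP]) + ord_p ∏_{w∣N⁺} c_w(E/K)`. Cases:
split at `p` — `CtlLoc.controlOnTreeAt_of_split_anyTorsion`; non-split — `X2.controlOnTreeAt_of_not_split_of_rankOne`.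
Cited facts BY NAME: `hGZK`, `hnf`, `hPT`, `hPT2`; Brink Thm. 2, Milne I 2.8 and `cd_p ≤ 2` are discharged by their
tree proofs. [cite: Castella2018, Thm. 2.3 (arXiv:1704.06608 p. 5)]
[cite: JetchevSkinnerWan2017, Thm. 3.3.1, Prop. 3.2.1, Prop. 3.3.2, Lemma 3.3.3, Prop. 3.3.4 (arXiv:1512.06894 pp. 10–13)]
[cite: Brink2007, Thm. 2 and Cor. 1 (pp. 2134–2136)] [cite: MilneADT2006, Ch. I, Thm. 4.10 and Thm. 2.8] -/
theorem controlOnTreeAt_of_mult_of_rankOne_odd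
    (hGZK : rank_eq_analyticRank_of_analyticRank_le_one) (hnf : exists_isNewformOf)
    (hPT : ∀ (K : Type) [Field K] [NumberField K], poitouTate_selmerStructure_duality K)
    (hPT2 : ∀ (K : Type) [Field K] [NumberField K], poitouTate_sha_tateDual K)
    (hp2 : p ≠ 2) (hmult : Mult W p) (hr : W.analyticRank = 1)
    {K : Type} [Field K] [NumberField K] (hK : IsImaginaryQuadratic K) (hsplit : SplitsIn K p)
    (hLt : (W.quadraticTwist (NumberField.discr K : ℚ)).entireLFunction 1 ≠ 0)
    (P : (W.baseChange K).toAffine.Point) (hPinf : ¬ IsOfFinAddOrder P)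
    (κ : ZpExtension K p) (hκ : κ.IsAnticyclotomic) (γ : absoluteGaloisGroup K)
    [Fact (κ.IsTopGenerator γ)] (𝔭 : HeightOneSpectrum (𝓞 K))
    (h𝔭 : ((p : ℕ) : 𝓞 K) ∈ 𝔭.asIdeal) (he : 𝔭.asIdeal.ramificationIdx (𝓞 ℚ) = 1)
    (hf : 𝔭.asIdeal.inertiaDeg (𝓞 ℚ) = 1) :
    ControlOnTreeAt p κ 𝔭 γ (embAt K p 𝔭 h𝔭 he hf) P := by
  have hEP : ∀ (K : Type) [Field K] [NumberField K] (v : HeightOneSpectrum (𝓞 K)),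
      localEulerPoincareCharacteristic (v.adicCompletion K) := fun K _ _ v ↦
    haveI : CharZero (v.adicCompletion K) := charZero_of_injective_algebraMap (algebraMap K _).injective
    localEulerPoincareCharacteristic_holds (v.adicCompletion K)
  have hBr : ∀ (K : Type) [Field K] [NumberField K] (p : ℕ) [Fact p.Prime],
      ZpExtension.decomp_not_le_kerSubgroup_of_isAnticyclotomic K p := fun K _ _ p _ ↦
    ZpExtension.decomp_not_le_kerSubgroup_of_isAnticyclotomic_holds (K := K) (p := p)
  by_cases hsW : W.HasSplitMultiplicativeReductionAtPrime p
  · exact Summit.BirchSwinnertonDyer.BirchSwinnertonDyer.Theorems.CtlLoc.controlOnTreeAt_of_split_anyTorsion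
      W p hGZK hnf hPT hPT2 hEP hBr hp2 hsW hr hK hsplit hLt P hPinf κ hκ γ 𝔭 h𝔭 he hf
  · exact X2.controlOnTreeAt_of_not_split_of_rankOne W p hGZK hnf hPT hPT2 hEP
      fieldCdLE_two_of_numberField_holds hBr hp2 hmult hsW hr hK hsplit hLt P hPinf κ hκ γ 𝔭 h𝔭 he hf

end Datum

/-! ### §2. (U2) on the corner frames of `Three.CornerUpperAt`, from the four cited facts -/

namespace Three

variable (W : WeierstrassCurve ℚ) [W.IsElliptic] [W.IsGloballyMinimal]

/-- **(U2) on the corner: the control identity at EVERY corner frame** — the `hctl` input of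
`Three.cornerUpperAt_of_coIMC_of_control` VERBATIM (every odd-`d_K` Manin-good Heegner datum of a corner pair with
`3 ∣ ∏c` and `L(E^{d_K},1) ≠ 0`, `P` the Heegner point of infinite order, every anticyclotomic `κ`, generator `γ`,
degree-one `𝔭 ∋ 3`) — from GZK, newforms and the two Poitou–Tate facts. `ClassX11b W 3` supplies `r_an = 1`,
`3 ≠ 2`, `Mult W 3`; the Heegner hypothesis makes `3 ∣ N_E` split in `K`; the binders `¬ Surj`, `3 ∣ ∏c`, `d_K`
odd, the Heegner parametrisation and `3 ∤ c` are NOT used (control is image-free). CONDITIONAL on the cited facts.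
[cite: Castella2018, Thm. 2.3 (arXiv:1704.06608 p. 5)] [cite: JetchevSkinnerWan2017, Thm. 3.3.1 (arXiv:1512.06894 p. 11)] -/
theorem cornerControlOnTree_of_facts [Fact (Nat.Prime 3)]
    (hGZK : rank_eq_analyticRank_of_analyticRank_le_one) (hnf : exists_isNewformOf)
    (hPT : ∀ (K : Type) [Field K] [NumberField K], poitouTate_selmerStructure_duality K)
    (hPT2 : ∀ (K : Type) [Field K] [NumberField K], poitouTate_sha_tateDual K) :
    ∀ (N : ℕ) [NeZero N] (K : Type) [Field K] [NumberField K]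
      (Dt : ModularParametrizationData W N) (H : HeegnerDatum N (NumberField.discr K)) (ι : K →+* ℂ)
      (P : (W.baseChange K).toAffine.Point),
      ClassX11b W 3 → ¬ Surj W 3 → 3 ∣ W.tamagawaProduct → W.conductorNorm ℤ = N →
      IsImaginaryQuadratic K → Odd (NumberField.discr K) → SatisfiesHeegnerHypothesis N K →
      (W.quadraticTwist (NumberField.discr K : ℚ)).entireLFunction 1 ≠ 0 →
      WeierstrassCurve.Affine.Point.map ι.toRatAlgHom P = heegnerPointComplex Dt H →
      ¬ (3 : ℤ) ∣ Dt.c → ¬ IsOfFinAddOrder P →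
      ∀ (κ : ZpExtension K 3), κ.IsAnticyclotomic →
        ∀ (γ : Field.absoluteGaloisGroup K) [Fact (κ.IsTopGenerator γ)]
          (𝔭 : HeightOneSpectrum (𝓞 K)) (h𝔭 : ((3 : ℕ) : 𝓞 K) ∈ 𝔭.asIdeal)
          (he : 𝔭.asIdeal.ramificationIdx (𝓞 ℚ) = 1) (hf : 𝔭.asIdeal.inertiaDeg (𝓞 ℚ) = 1),
          ControlOnTreeAt 3 κ 𝔭 γ (embAt K 3 𝔭 h𝔭 he hf) P := by
  intro N _ K _ _ Dt H ι P hX _ _ hN hK _ hHN hLt _ _ hPinf κ hκ γ _ 𝔭 h𝔭 he hf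
  obtain ⟨hr, hp2, hmult, -⟩ := id hX
  have hpN : 3 ∣ N := hN ▸ dvd_conductorNorm_of_mult hmult
  have hsplit : SplitsIn K 3 := hHN 3 Fact.out hpN
  exact controlOnTreeAt_of_mult_of_rankOne_odd W 3 hGZK hnf hPT hPT2 hp2 hmult hr hK hsplit hLt P hPinf κ
    hκ γ 𝔭 h𝔭 he hf

/-- **`Three.CornerUpperAt W` FROM (U1) ALONE + four cited facts.** The Tamagawa-sharp Kolyvagin bound over `K` on the
(T4″)@3 corner from the Kolyvagin-SYSTEM direction of the anticyclotomic main conjecture at `𝟙` on the corner frames —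
`hco`: for the generator `f_ac` of `Ch_Λ(X_ac)` of the constructed `X_ac = AcSelmer.XAc (E_K) 3 κ 𝔭 ∅ γ`,
`ord₃ f_ac(0) ≤ 2(ord₃ log_ω P − 1)` (Howard 2004 Thm. B / the «⊆» half of the BDP main conjecture read at `𝟙`
through Cas18 Thm. 3.2; OPEN at `p = 3` for an image in the normaliser of a Cartan) — the control input being
`cornerControlOnTree_of_facts`. CONDITIONAL on (U1) and the cited facts; nothing booked; item 19111 stays open.
[cite: JetchevSkinnerWan2017, §7.4.2 (eq:shaupper) (arXiv:1512.06894 p. 31)]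
[cite: Castella2018, Thm. 2.3 (p. 5), Thm. 3.2 (p. 9)] [cite: GrossLMS1991, §2 Conj. (2.2) (shape)] -/
theorem cornerUpperAt_of_coIMC_of_facts [Fact (Nat.Prime 3)]
    (hGZK : rank_eq_analyticRank_of_analyticRank_le_one) (hnf : exists_isNewformOf)
    (hPT : ∀ (K : Type) [Field K] [NumberField K], poitouTate_selmerStructure_duality K)
    (hPT2 : ∀ (K : Type) [Field K] [NumberField K], poitouTate_sha_tateDual K)
    (hco : ∀ (N : ℕ) [NeZero N] (K : Type) [Field K] [NumberField K]
      (Dt : ModularParametrizationData W N) (H : HeegnerDatum N (NumberField.discr K)) (ι : K →+* ℂ)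
      (P : (W.baseChange K).toAffine.Point),
      ClassX11b W 3 → ¬ Surj W 3 → 3 ∣ W.tamagawaProduct → W.conductorNorm ℤ = N →
      IsImaginaryQuadratic K → Odd (NumberField.discr K) → SatisfiesHeegnerHypothesis N K →
      (W.quadraticTwist (NumberField.discr K : ℚ)).entireLFunction 1 ≠ 0 →
      WeierstrassCurve.Affine.Point.map ι.toRatAlgHom P = heegnerPointComplex Dt H →
      ¬ (3 : ℤ) ∣ Dt.c → ¬ IsOfFinAddOrder P →
      ∀ (κ : ZpExtension K 3), κ.IsAnticyclotomic →
        ∀ (γ : Field.absoluteGaloisGroup K) [Fact (κ.IsTopGenerator γ)]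
          (𝔭 : HeightOneSpectrum (𝓞 K)) (h𝔭 : ((3 : ℕ) : 𝓞 K) ∈ 𝔭.asIdeal)
          (he : 𝔭.asIdeal.ramificationIdx (𝓞 ℚ) = 1) (hf : 𝔭.asIdeal.inertiaDeg (𝓞 ℚ) = 1),
          ∃ n : ℕ, XAc.HasCharValuationAt (W.baseChange K) 3 κ 𝔭 ∅ γ n ∧
            (n : ℤ) ≤ 2 * (padicLogOrd W 3 (embAt K 3 𝔭 h𝔭 he hf) P - 1)) :
    CornerUpperAt W :=
  cornerUpperAt_of_coIMC_of_control W hco (cornerControlOnTree_of_facts W hGZK hnf hPT hPT2)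

/-- **The registered stub BY NAME from (U1) alone + four cited facts**: `Theorems.CornerAtThreeUpper` (p488767; =
`∀ W, Three.CornerUpperAt W`, stub `stub_cornerUpper3` of the 19111 skeleton `Lines/birth.lean`) from the
Kolyvagin-system direction at `𝟙` on the corner frames `∀ W`. CONDITIONAL; closes nothing.
[cite: JetchevSkinnerWan2017, §7.4.2 (eq:shaupper) (arXiv:1512.06894 p. 31)] -/
theorem cornerAtThreeUpper_of_coIMC_of_facts [Fact (Nat.Prime 3)]
    (hGZK : rank_eq_analyticRank_of_analyticRank_le_one) (hnf : exists_isNewformOf)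
    (hPT : ∀ (K : Type) [Field K] [NumberField K], poitouTate_selmerStructure_duality K)
    (hPT2 : ∀ (K : Type) [Field K] [NumberField K], poitouTate_sha_tateDual K)
    (hco : ∀ (W : WeierstrassCurve ℚ) [W.IsElliptic] [W.IsGloballyMinimal]
      (N : ℕ) [NeZero N] (K : Type) [Field K] [NumberField K]
      (Dt : ModularParametrizationData W N) (H : HeegnerDatum N (NumberField.discr K)) (ι : K →+* ℂ)
      (P : (W.baseChange K).toAffine.Point),
      ClassX11b W 3 → ¬ Surj W 3 → 3 ∣ W.tamagawaProduct → W.conductorNorm ℤ = N →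
      IsImaginaryQuadratic K → Odd (NumberField.discr K) → SatisfiesHeegnerHypothesis N K →
      (W.quadraticTwist (NumberField.discr K : ℚ)).entireLFunction 1 ≠ 0 →
      WeierstrassCurve.Affine.Point.map ι.toRatAlgHom P = heegnerPointComplex Dt H →
      ¬ (3 : ℤ) ∣ Dt.c → ¬ IsOfFinAddOrder P →
      ∀ (κ : ZpExtension K 3), κ.IsAnticyclotomic →
        ∀ (γ : Field.absoluteGaloisGroup K) [Fact (κ.IsTopGenerator γ)]
          (𝔭 : HeightOneSpectrum (𝓞 K)) (h𝔭 : ((3 : ℕ) : 𝓞 K) ∈ 𝔭.asIdeal)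
          (he : 𝔭.asIdeal.ramificationIdx (𝓞 ℚ) = 1) (hf : 𝔭.asIdeal.inertiaDeg (𝓞 ℚ) = 1),
          ∃ n : ℕ, XAc.HasCharValuationAt (W.baseChange K) 3 κ 𝔭 ∅ γ n ∧
            (n : ℤ) ≤ 2 * (padicLogOrd W 3 (embAt K 3 𝔭 h𝔭 he hf) P - 1)) :
    Summit.BirchSwinnertonDyer.BirchSwinnertonDyer.Theorems.CornerAtThreeUpper :=
  fun W _ _ ↦ cornerUpperAt_of_coIMC_of_facts W hGZK hnf hPT hPT2 (hco W)

end Three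

end Summit.BirchSwinnertonDyer.Rank1Residual.X11b

end
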